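import Mathlib
import Summits.ABC.IUTFork.Joshi.ThetaValuesLocusModelPadic
import HarnessLib

/-!
# A character `Χ : ℚ → Q̄_pˣ` with `‖Χ(q)‖ = ‖p‖^q` — Mathlib-side input for the kernel MODEL of the §5 period-ring tower
# (branch E vacuity check for slot T-09's `PeriodRingTower` / `BEDatum`)

Support file of the abc-iut cell, branch E (rung LADDER-ABC:A2.E; seat abc-iut-E-t9; E-plan-2 ruling 2026-08-26T08:36:44Z (2)
«`Joshi/LocalPeriodRingsModel.lean` = E-t9»). Pure Mathlib number theory, no Joshi or [IUTchIII] content, nothing asserted about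
any author's mathematics. It supplies the one non-trivial ingredient of the model `Joshi/LocalPeriodRingsModel.lean`: a GROUP
HOMOMORPHISM `Χ : ℚ → Q̄_pˣ` (`Q̄_p = PadicAlgCl p` with its spectral norm) extending `1 ↦ p`, hence with `‖Χ(q)‖ = ‖p‖^q` for every
rational `q` — the «compatible system of rational powers of `p`» through which the model's residue maps `η_y` read the exponent
`q` of a monomial `T^q` at the twist `e_y` (`η_y(T^q) = Χ(q/e_y)`).

Construction: the unit group of an algebraically closed field is divisible (`IsAlgClosed.exists_pow_nat_eq`), so `Additive Q̄_pˣ`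
is a divisible, hence (Baer) injective, `ℤ`-module (Mathlib `Module.Baer.of_divisible`), and the `ℤ`-linear map `ℤ → Additive Q̄_pˣ`,
`n ↦ pⁿ`, extends along `ℤ ↪ ℚ` (`Module.Injective.out`). The norm identity follows from `Χ(q)^{den q} = p^{num q}` by taking the
positive real `den q`-th root. Declarations: `units_zpow_surjective`, `divisibleByUnits` (a `def`, not an instance), `exists_ratHom`,
`chiUnits`, `chi`, `chi_intCast`, `chi_one`, `norm_chi` (`0 < ‖p‖`, `(p : Q̄_p) ≠ 0` are the tree's
`Literature.NumberTheory.LFunctions.PadicRootsOfUnity.norm_p_pos` / `…IwasawaLog.natCast_prime_ne_zero`, not restated). [folklore]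
-/

noncomputable section

namespace Summit.ABC.IUTFork.Joshi.Model

variable (p : ℕ) [hp : Fact p.Prime]

/-- The unit `p ∈ Q̄_pˣ` (`(p : Q̄_p) ≠ 0`, cf. the tree's `Literature.NumberTheory.Transcendental.IwasawaLog.natCast_prime_ne_zero`).
[folklore] -/
def pUnit : (PadicAlgCl p)ˣ := Units.mk0 (p : PadicAlgCl p) (by exact_mod_cast hp.out.ne_zero)

/-- `(pUnit : Q̄_p) = p`. [folklore] -/
@[simp] theorem coe_pUnit : ((pUnit p : (PadicAlgCl p)ˣ) : PadicAlgCl p) = p := rfl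

/-- **The unit group of `Q̄_p` is divisible**: `u ↦ uⁿ` is onto for every `n ≠ 0` (`n`-th roots exist in an algebraically closed
field; for `n < 0` invert a root of `u`). [folklore] -/
theorem units_zpow_surjective {n : ℤ} (hn : n ≠ 0) : Function.Surjective fun u : (PadicAlgCl p)ˣ => u ^ n := by
  -- first natural exponents
  have hnat : ∀ {m : ℕ}, 0 < m → ∀ u : (PadicAlgCl p)ˣ, ∃ w : (PadicAlgCl p)ˣ, w ^ m = u := by
    intro m hm u
    obtain ⟨z, hz⟩ := IsAlgClosed.exists_pow_nat_eq (u : PadicAlgCl p) hm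
    have hz0 : z ≠ 0 := by
      rintro rfl
      rw [zero_pow hm.ne'] at hz
      exact u.ne_zero hz.symm
    exact ⟨Units.mk0 z hz0, Units.ext (by simpa using hz)⟩
  intro u
  rcases lt_or_gt_of_ne hn with h | h
  · obtain ⟨w, hw⟩ := hnat (m := (-n).toNat) (by omega) u
    refine ⟨w⁻¹, ?_⟩
    have hn' : ((-n).toNat : ℤ) = -n := Int.toNat_of_nonneg (by omega)
    change w⁻¹ ^ n = u
    rw [inv_zpow', ← hn', zpow_natCast, hw]
  · obtain ⟨w, hw⟩ := hnat (m := n.toNat) (by omega) u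
    refine ⟨w, ?_⟩
    have hn' : (n.toNat : ℤ) = n := Int.toNat_of_nonneg h.le
    change w ^ n = u
    rw [← hn', zpow_natCast, hw]

/-- `Additive Q̄_pˣ` is a divisible `ℤ`-module (a DEFINITION, not an instance; bound locally with `letI`). [folklore] -/
@[reducible] def divisibleByUnits : DivisibleBy (Additive (PadicAlgCl p)ˣ) ℤ :=
  divisibleByOfSMulRightSurj _ ℤ fun {n} hn a => by
    obtain ⟨u, hu⟩ := units_zpow_surjective p hn (Additive.toMul a)
    exact ⟨Additive.ofMul u, by
      apply Additive.toMul.injective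
      rw [toMul_zsmul, toMul_ofMul]
      exact hu⟩

/-- **A `ℤ`-linear map `ℚ → Additive Q̄_pˣ` extending `n ↦ pⁿ`** exists (Baer: divisible ⇒ injective `ℤ`-module; extend along
`ℤ ↪ ℚ`). [folklore] -/
theorem exists_ratHom : ∃ h : ℚ →ₗ[ℤ] Additive (PadicAlgCl p)ˣ, h 1 = Additive.ofMul (pUnit p) := by
  letI := divisibleByUnits p
  have hinj : Module.Injective ℤ (Additive (PadicAlgCl p)ˣ) := (Module.Baer.of_divisible _).injective
  let f : ℤ →ₗ[ℤ] ℚ := (Int.castAddHom ℚ).toIntLinearMap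
  let g : ℤ →ₗ[ℤ] Additive (PadicAlgCl p)ˣ := LinearMap.toSpanSingleton ℤ _ (Additive.ofMul (pUnit p))
  obtain ⟨h, hh⟩ := hinj.out f (fun a b hab => by simpa [f] using hab) g
  refine ⟨h, ?_⟩
  have h1 := hh 1
  have hf1 : f 1 = 1 := by simp [f]
  rw [hf1] at h1
  rw [h1]
  simp [g]

/-- The chosen `ℤ`-linear extension `ℚ → Additive Q̄_pˣ` of `n ↦ pⁿ`. [folklore] -/
def ratHom : ℚ →ₗ[ℤ] Additive (PadicAlgCl p)ˣ := (exists_ratHom p).choose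

/-- `ratHom 1 = p`. [folklore] -/
theorem ratHom_one : ratHom p 1 = Additive.ofMul (pUnit p) := (exists_ratHom p).choose_spec

/-- **`Χ : ℚ → Q̄_pˣ`** as a monoid homomorphism on `Multiplicative ℚ`. [folklore] -/
def chiUnits : Multiplicative ℚ →* (PadicAlgCl p)ˣ :=
  AddMonoidHom.toMultiplicativeLeft (ratHom p).toAddMonoidHom

/-- **`Χ : ℚ → Q̄_p`** (values in `Q̄_p`, all units), the character used by the model's residue maps. [folklore] -/
def chi : Multiplicative ℚ →* PadicAlgCl p := (Units.coeHom (PadicAlgCl p)).comp (chiUnits p)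

/-- `Χ(q) = ratHom q` read multiplicatively. [folklore] -/
theorem chiUnits_apply (q : ℚ) : chiUnits p (Multiplicative.ofAdd q) = Additive.toMul (ratHom p q) := rfl

/-- `Χ(q)` as an element of `Q̄_p` is the underlying value of the unit. [folklore] -/
theorem chi_apply (q : ℚ) : chi p (Multiplicative.ofAdd q) = ((chiUnits p (Multiplicative.ofAdd q) : (PadicAlgCl p)ˣ) : PadicAlgCl p) :=
  rfl

/-- `Χ(q) ≠ 0`. [folklore] -/
theorem chi_ne_zero (q : Multiplicative ℚ) : chi p q ≠ 0 := (chiUnits p q).ne_zero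

/-- `Χ(1) = p`. [folklore] -/
theorem chi_one : chi p (Multiplicative.ofAdd 1) = p := by
  rw [chi_apply, chiUnits_apply, ratHom_one, toMul_ofMul, coe_pUnit]

/-- `Χ(n·q) = Χ(q)ⁿ` for `n ∈ ℤ` (`ℤ`-linearity). [folklore] -/
theorem chiUnits_zsmul (n : ℤ) (q : ℚ) :
    chiUnits p (Multiplicative.ofAdd ((n : ℚ) * q)) = chiUnits p (Multiplicative.ofAdd q) ^ n := by
  rw [chiUnits_apply, chiUnits_apply, ← zsmul_eq_mul, map_zsmul, toMul_zsmul]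

/-- `Χ(n) = pⁿ` for `n ∈ ℤ`. [folklore] -/
theorem chi_intCast (n : ℤ) : chi p (Multiplicative.ofAdd (n : ℚ)) = (p : PadicAlgCl p) ^ n := by
  have h := chiUnits_zsmul p n 1
  rw [mul_one] at h
  rw [chi_apply, h, Units.val_zpow_eq_zpow_val, ← chi_apply, chi_one]

/-- `Χ(q)^{den q} = p^{num q}`. [folklore] -/
theorem chi_pow_den (q : ℚ) : chi p (Multiplicative.ofAdd q) ^ q.den = (p : PadicAlgCl p) ^ q.num := by
  have h := chiUnits_zsmul p (q.den : ℤ) q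
  rw [Int.cast_natCast, Rat.den_mul_eq_num, zpow_natCast] at h
  rw [chi_apply, ← Units.val_pow_eq_pow_val, ← h, ← chi_apply, chi_intCast]

/-- **`‖Χ(q)‖ = ‖p‖^q`** for every rational `q`. [folklore] -/
theorem norm_chi (q : ℚ) : ‖chi p (Multiplicative.ofAdd q)‖ = ‖(p : PadicAlgCl p)‖ ^ (q : ℝ) := by
  have hden : (0 : ℝ) < q.den := by exact_mod_cast q.den_pos
  have hnn : 0 ≤ ‖chi p (Multiplicative.ofAdd q)‖ := norm_nonneg _
  -- ‖Χ q‖^den = ‖p‖^num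
  have h : ‖chi p (Multiplicative.ofAdd q)‖ ^ (q.den : ℝ) = ‖(p : PadicAlgCl p)‖ ^ (q.num : ℝ) := by
    rw [Real.rpow_natCast, ← norm_pow, chi_pow_den, norm_zpow, Real.rpow_intCast]
  -- take the `den`-th root
  have h' : ‖chi p (Multiplicative.ofAdd q)‖ = (‖(p : PadicAlgCl p)‖ ^ (q.num : ℝ)) ^ ((q.den : ℝ)⁻¹) := by
    rw [← h, ← Real.rpow_mul hnn, mul_inv_cancel₀ hden.ne', Real.rpow_one]
  rw [h', ← Real.rpow_mul (norm_nonneg _)]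
  congr 1
  rw [Rat.cast_def, div_eq_mul_inv]

end Summit.ABC.IUTFork.Joshi.Model

end
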